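import Summits.ResolutionOfSingularities.ResolutionOfSingularities.Theorems.EquisingularLiftEquisingularLiftNatPlaneCurveUnobs
import Summits.ResolutionOfSingularities.ResolutionOfSingularities.Theorems.EquisingularLiftEquisingularLiftNatProjLinearAut
import Summits.ResolutionOfSingularities.ResolutionOfSingularities.Theorems.EquisingularLiftEquisingularLiftNatDirStepUnobsHostChange
import Literature.AlgebraicGeometry.Resolution.PlaneNearPointLemmas
import HarnessLib

/-!
# [OURS · L1 W4.5(b) · EL♮(3) · WIDTH TABLE D3/D4 certificate currency, brick (L1)] PLANE CURVES UNDER LINEAR CHANGES OF COORDINATES, and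
# EVERY LINE IN `ℙ²_k` IS UNOBSTRUCTED — hypothesis-free

Cell `res-hironaka`, LADDER-RESOLUTION rung L (D-0089), slot W4.5(b), crux chain w45b: child crux **EL♮(3)** = stmt-ResolutionOfSingularities-20148.
WIDTH seat res-L1-w45b-iso-w4 g2 (D-0157 DOOR 1); sequel of (L) ✓ `…NatProjLinearAut` (linear automorphisms of `ℙⁿ_k`) over res-L1-w45b-iso-w2's
✓ `PlaneCurveSplit.dirStepUnobs_planeCurve` (`…NatPlaneCurveUnobs`: every plane curve with a unit `X₀^d`-coefficient and radical chart equations is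
unobstructed). `--supports stmt-ResolutionOfSingularities-20148 --as helper`. OURS; NOT a statement of H. Hironaka's 2017 manuscript (nothing of
[Hironaka2017] is asserted); AI-written, and AI review is weaker than expert review. DEF-FREE; no `sorry`; standard axioms. EL♮(3) is NOT proved here;
resolution of singularities in positive characteristic is NOT proved here (dimension 3 is Cossart–Piltant 2008/2009 in print); counted 0 toward the summit.

WHAT.
* `ProjLin.dirStepUnobs_planeCurve_of_iso` — iso-w2's certificate transported along any isomorphism `ℙ²_k ≅ Y` onto a reduced scheme (B0 + host kit,
  as `S10Conic.dirStepUnobs_conic_of_iso`);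
* ★ `ProjLin.dirStepUnobs_planeCurve_linearChange` — … and along every linear change of coordinates `B` (`IsUnit B.det`):
  `DirStepUnobs ℙ²_k univ _ V₊(F ∘ B) _` whenever `F` satisfies iso-w2's hypotheses in the standard frame (`ProjLin.exists_iso_image_zeroLocus`);
* `ProjLin.dirStepUnobs_line_X_zero` — the normal-form line `V₊(X₀)` (iso-w2's theorem at `d = 1`: `hu` = coefficient `1`, chart equations `y₀`, prime);
* ★★ `ProjLin.dirStepUnobs_line` — **EVERY LINE `V₊(a₀X₀ + a₁X₁ + a₂X₂)`, `a ≠ 0`, IS UNOBSTRUCTED IN `ℙ²_k`** (`𝒩 = 𝒪_{ℙ¹}(1)`, `H¹ = 0`), no frame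
  hypothesis: `a₀X₀ + a₁X₁ + a₂X₂ = X₀ ∘ B` for an invertible `B` completing the row `a` (three cases). This is the model statement the NEST-LINE clauses
  of WIDTH TABLE D4 («hosted nose + prefix NEST», lines `ℓ_x` in fresh planes) consume through res-L1-w45b-iso-w2's doors ✓ p655267 (H2) / ✓ p656762 (∀e,
  with `…_of_iso`), whatever the coordinates of `ℓ_x`.

References (index only): J. Harris, *Algebraic Geometry: A First Course* (1992), Lecture 1 p. 4 [cite: Harris1992]; R. Hartshorne, *Algebraic Geometry*
(1977), III.5 [cite: Hartshorne1977].
-/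

set_option linter.dupNamespace false

noncomputable section

-- `Proj`/`ProjectiveSpectrum` carrier coercions under `instances` transparency (as in the chain's other chart files).
set_option backward.isDefEq.respectTransparency false

open CategoryTheory AlgebraicGeometry MvPolynomial HomogeneousLocalization

namespace Summit.ResolutionOfSingularities.ResolutionOfSingularities.Cruxes.EquisingularLiftNat.Sections

namespace ProjLin

open Literature.AlgebraicGeometry.Motives Literature.AlgebraicGeometry.Motives.ProjectiveSpace Literature.AlgebraicGeometry.ProjectiveSpace

variable (k : Type) [Field k]

attribute [local instance] MvPolynomial.gradedAlgebra ProjBaseChange.algebraBase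

/-! ### Plane curves along isomorphisms and linear changes of coordinates -/

/-- **iso-w2's plane-curve certificate along any isomorphism** onto a reduced scheme `Y`: `DirStepUnobs Y univ _ (φ '' V₊(F)) hZ`
(transport by B0 `dirStepUnobs_transport` with the host kit's `exists_isIso_redSub_univ_over` / `exists_isIso_redSub_image`).
[OURS · L1 W4.5b · EL♮(3) · (L1); NOT a statement of the manuscript; counted 0] -/
theorem dirStepUnobs_planeCurve_of_iso {d : ℕ} (F : MvPolynomial (Fin 3) k) (hF : F.IsHomogeneous d) (hd : 0 < d)
    (hu : IsUnit (coeff (Finsupp.single 0 d) F))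
    (hrad₁ : (Ideal.span {SmoothHypersurface.chartEqn F 1 hF}).IsRadical) (hrad₂ : (Ideal.span {SmoothHypersurface.chartEqn F 2 hF}).IsRadical)
    {Y : Scheme.{0}} [IsReduced Y] (φ : Proj (MvPolynomial.homogeneousSubmodule (Fin 3) k) ≅ Y)
    (hZ : IsClosed ((φ.hom : Proj (MvPolynomial.homogeneousSubmodule (Fin 3) k) → Y) '' (SmoothHypersurface.zeroLocusClosed F : Set _))) :
    DirStepUnobs Y Set.univ isClosed_univ
      ((φ.hom : Proj (MvPolynomial.homogeneousSubmodule (Fin 3) k) → Y) '' (SmoothHypersurface.zeroLocusClosed F : Set _)) hZ := by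
  haveI : IsIntegral (Proj (MvPolynomial.homogeneousSubmodule (Fin 3) k)) :=
    Literature.AlgebraicGeometry.Resolution.isIntegral_projectiveSpace 2 k
  obtain ⟨ε, hε, hεiso⟩ := exists_isIso_redSub_univ_over φ.hom
  haveI := hεiso
  obtain ⟨hc, εZ, hεZ, hεZiso⟩ := exists_isIso_redSub_image φ.hom (E := Set.univ) isClosed_univ isClosed_univ ε hε
    (SmoothHypersurface.zeroLocusClosed F).isClosed (Set.subset_univ _)
  exact dirStepUnobs_transport (Proj (MvPolynomial.homogeneousSubmodule (Fin 3) k)) Set.univ isClosed_univ _ _ Y φ.hom Set.univ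
    isClosed_univ _ hc ε εZ (Set.subset_univ _) (Set.subset_univ _) hεiso hε hεZiso hεZ
    (PlaneCurveSplit.dirStepUnobs_planeCurve F hF hd hu hrad₁ hrad₂)

/-- ★ **Plane curves along linear changes of coordinates**: for `F` as in `dirStepUnobs_planeCurve` (standard frame) and an invertible `B`, the
projectively equivalent curve `V₊(F ∘ B)` is unobstructed in `ℙ²_k`. [cite: Harris1992, Lecture 1 (p. 4)]
[OURS · L1 W4.5b · EL♮(3) · (L1); NOT a statement of the manuscript; counted 0] -/
theorem dirStepUnobs_planeCurve_linearChange {d : ℕ} (F : MvPolynomial (Fin 3) k) (hF : F.IsHomogeneous d) (hd : 0 < d)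
    (hu : IsUnit (coeff (Finsupp.single 0 d) F))
    (hrad₁ : (Ideal.span {SmoothHypersurface.chartEqn F 1 hF}).IsRadical) (hrad₂ : (Ideal.span {SmoothHypersurface.chartEqn F 2 hF}).IsRadical)
    (B : Matrix (Fin 3) (Fin 3) k) (hB : IsUnit B.det)
    (hZ : IsClosed (SmoothHypersurface.zeroLocusClosed (aeval B.toMvPolynomial F) : Set (Proj (MvPolynomial.homogeneousSubmodule (Fin 3) k)))) :
    DirStepUnobs (Proj (MvPolynomial.homogeneousSubmodule (Fin 3) k)) Set.univ isClosed_univ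
      (SmoothHypersurface.zeroLocusClosed (aeval B.toMvPolynomial F) : Set (Proj (MvPolynomial.homogeneousSubmodule (Fin 3) k))) hZ := by
  classical
  haveI : IsIntegral (Proj (MvPolynomial.homogeneousSubmodule (Fin 3) k)) :=
    Literature.AlgebraicGeometry.Resolution.isIntegral_projectiveSpace 2 k
  have hB' : IsUnit B⁻¹.det := Matrix.isUnit_nonsing_inv_det_iff.2 hB
  obtain ⟨φ, hφ⟩ := ProjLin.exists_iso_image_zeroLocus (n := 2) hB'
  have himage : (φ.hom : Proj (MvPolynomial.homogeneousSubmodule (Fin 3) k) → Proj (MvPolynomial.homogeneousSubmodule (Fin 3) k)) ''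
      (SmoothHypersurface.zeroLocusClosed F : Set _) =
      (SmoothHypersurface.zeroLocusClosed (aeval B.toMvPolynomial F) : Set (Proj (MvPolynomial.homogeneousSubmodule (Fin 3) k))) := by
    have h := hφ (aeval B.toMvPolynomial F)
    rw [aeval_toMvPolynomial_inv_right hB] at h
    rw [SmoothHypersurface.coe_zeroLocusClosed, SmoothHypersurface.coe_zeroLocusClosed]
    exact h
  have hc : IsClosed ((φ.hom : Proj (MvPolynomial.homogeneousSubmodule (Fin 3) k) → Proj (MvPolynomial.homogeneousSubmodule (Fin 3) k)) ''
      (SmoothHypersurface.zeroLocusClosed F : Set _)) := by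
    rw [himage]; exact hZ
  exact (dirStepUnobs_congr_set himage).1 (dirStepUnobs_planeCurve_of_iso k F hF hd hu hrad₁ hrad₂ φ hc)

/-! ### Lines -/

/-- The chart equation of the line `V₊(X₀)` on `D₊(Xᵢ)`, `i = 1, 2`, is `toChart (y₀)`. [folklore] -/
theorem chartEqn_X_zero_eq (i : Fin 3) (hi : i = 1 ∨ i = 2) :
    SmoothHypersurface.chartEqn (X 0 : MvPolynomial (Fin 3) k) i (isHomogeneous_X k 0) = toChart k i (X 0) := by
  rw [SmoothHypersurface.chartEqn, isLocalizationElem_X]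
  rcases hi with rfl | rfl
  · have h : dehomogenize k 1 (X 0 : MvPolynomial (Fin 3) k) = X 0 := by simpa using dehomogenize_X_succAbove k (1 : Fin 3) (0 : Fin 2)
    rw [h]
  · have h : dehomogenize k 2 (X 0 : MvPolynomial (Fin 3) k) = X 0 := by simpa using dehomogenize_X_succAbove k (2 : Fin 3) (0 : Fin 2)
    rw [h]

/-- `(toChart y₀)` is a radical (indeed prime) ideal of the chart ring `(k[X]_{(Xᵢ)})₀ ≅ k[y₀, y₁]`. [folklore] -/
theorem isRadical_span_toChart_X_zero (i : Fin 3) :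
    (Ideal.span {toChart k i (X 0 : MvPolynomial (Fin 2) k)}).IsRadical := by
  have hprime : (Ideal.span {(X 0 : MvPolynomial (Fin 2) k)}).IsPrime := by
    have hker := Literature.AlgebraicGeometry.Resolution.ker_aeval_vecCons_X k (0 : Polynomial k)
    rw [map_zero, sub_zero] at hker
    rw [← hker]
    exact RingHom.ker_isPrime _
  have h : Ideal.span {toChart k i (X 0 : MvPolynomial (Fin 2) k)} =
      Ideal.map (chartAlgEquiv k i).symm (Ideal.span {(X 0 : MvPolynomial (Fin 2) k)}) := by
    rw [Ideal.map_span, Set.image_singleton]; rfl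
  rw [h]
  haveI := hprime
  exact (Ideal.map_isPrime_of_equiv _).isRadical

/-- **The normal-form line `V₊(X₀)` is unobstructed in `ℙ²_k`** (iso-w2's `dirStepUnobs_planeCurve` at `d = 1`). [cite: Hartshorne1977, III.5]
[OURS · L1 W4.5b · EL♮(3) · (L1); NOT a statement of the manuscript; counted 0] -/
theorem dirStepUnobs_line_X_zero :
    DirStepUnobs (Proj (MvPolynomial.homogeneousSubmodule (Fin 3) k)) Set.univ isClosed_univ
      (SmoothHypersurface.zeroLocusClosed (X 0 : MvPolynomial (Fin 3) k) : Set _)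
      (SmoothHypersurface.zeroLocusClosed (X 0 : MvPolynomial (Fin 3) k)).isClosed := by
  classical
  refine PlaneCurveSplit.dirStepUnobs_planeCurve (X 0 : MvPolynomial (Fin 3) k) (isHomogeneous_X k 0) one_pos ?_ ?_ ?_
  · rw [MvPolynomial.coeff_X]; simp
  · rw [chartEqn_X_zero_eq k 1 (Or.inl rfl)]; exact isRadical_span_toChart_X_zero k 1
  · rw [chartEqn_X_zero_eq k 2 (Or.inr rfl)]; exact isRadical_span_toChart_X_zero k 2

/-- A row completion: for `a : Fin 3 → k`, `a ≠ 0`, an invertible `3 × 3` matrix with first row `a`. [folklore] -/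
theorem exists_matrix_row_zero_eq (a : Fin 3 → k) (ha : a ≠ 0) :
    ∃ B : Matrix (Fin 3) (Fin 3) k, IsUnit B.det ∧ ∀ j, B 0 j = a j := by
  by_cases h0 : a 0 ≠ 0
  · refine ⟨!![a 0, a 1, a 2; 0, 1, 0; 0, 0, 1], ?_, fun j => by fin_cases j <;> rfl⟩
    have hdet : Matrix.det !![a 0, a 1, a 2; 0, 1, 0; 0, 0, 1] = a 0 := by
      rw [Matrix.det_fin_three]; simp
    rw [hdet]; exact isUnit_iff_ne_zero.2 h0
  rw [not_not] at h0
  by_cases h1 : a 1 ≠ 0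
  · refine ⟨!![a 0, a 1, a 2; 1, 0, 0; 0, 0, 1], ?_, fun j => by fin_cases j <;> rfl⟩
    have hdet : Matrix.det !![a 0, a 1, a 2; 1, 0, 0; 0, 0, 1] = -a 1 := by
      rw [Matrix.det_fin_three]; simp
    rw [hdet]; exact (isUnit_iff_ne_zero.2 h1).neg
  rw [not_not] at h1
  have h2 : a 2 ≠ 0 := by
    intro h2; apply ha; funext j; fin_cases j
    · exact h0
    · exact h1
    · exact h2
  refine ⟨!![a 0, a 1, a 2; 1, 0, 0; 0, 1, 0], ?_, fun j => by fin_cases j <;> rfl⟩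
  have hdet : Matrix.det !![a 0, a 1, a 2; 1, 0, 0; 0, 1, 0] = a 2 := by
    rw [Matrix.det_fin_three]; simp
  rw [hdet]; exact isUnit_iff_ne_zero.2 h2

/-- ★★ **EVERY LINE IN `ℙ²_k` IS UNOBSTRUCTED**: for `a : Fin 3 → k`, `a ≠ 0`, and any closedness witness `hZ`,
`DirStepUnobs ℙ²_k univ _ V₊(a₀X₀ + a₁X₁ + a₂X₂) hZ` (`H¹(ℙ¹, 𝒪(1)) = 0`; no frame hypothesis). [cite: Hartshorne1977, III.5]
[OURS · L1 W4.5b · EL♮(3) · (L1); NOT a statement of the manuscript; counted 0] -/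
theorem dirStepUnobs_line (a : Fin 3 → k) (ha : a ≠ 0)
    (hZ : IsClosed (SmoothHypersurface.zeroLocusClosed (∑ j, C (a j) * X j : MvPolynomial (Fin 3) k) :
      Set (Proj (MvPolynomial.homogeneousSubmodule (Fin 3) k)))) :
    DirStepUnobs (Proj (MvPolynomial.homogeneousSubmodule (Fin 3) k)) Set.univ isClosed_univ
      (SmoothHypersurface.zeroLocusClosed (∑ j, C (a j) * X j : MvPolynomial (Fin 3) k) : Set (Proj (MvPolynomial.homogeneousSubmodule (Fin 3) k)))
      hZ := by
  classical
  obtain ⟨B, hB, hrow⟩ := exists_matrix_row_zero_eq k a ha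
  have hline : aeval B.toMvPolynomial (X 0 : MvPolynomial (Fin 3) k) = ∑ j, C (a j) * X j := by
    rw [aeval_X, Matrix.toMvPolynomial]
    refine Finset.sum_congr rfl fun j _ => ?_
    rw [hrow j, C_mul_X_eq_monomial]
  have hZ' : IsClosed (SmoothHypersurface.zeroLocusClosed (aeval B.toMvPolynomial (X 0 : MvPolynomial (Fin 3) k)) :
      Set (Proj (MvPolynomial.homogeneousSubmodule (Fin 3) k))) := by rw [hline]; exact hZ
  have h := dirStepUnobs_planeCurve_linearChange k (X 0 : MvPolynomial (Fin 3) k) (isHomogeneous_X k 0) one_pos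
    (by rw [MvPolynomial.coeff_X]; simp)
    (by rw [chartEqn_X_zero_eq k 1 (Or.inl rfl)]; exact isRadical_span_toChart_X_zero k 1)
    (by rw [chartEqn_X_zero_eq k 2 (Or.inr rfl)]; exact isRadical_span_toChart_X_zero k 2) B hB hZ'
  have hset : (SmoothHypersurface.zeroLocusClosed (aeval B.toMvPolynomial (X 0 : MvPolynomial (Fin 3) k)) :
      Set (Proj (MvPolynomial.homogeneousSubmodule (Fin 3) k))) =
      (SmoothHypersurface.zeroLocusClosed (∑ j, C (a j) * X j : MvPolynomial (Fin 3) k) : Set _) := by rw [hline]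
  exact (dirStepUnobs_congr_set hset).1 h

end ProjLin

end Summit.ResolutionOfSingularities.ResolutionOfSingularities.Cruxes.EquisingularLiftNat.Sections

end
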